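import Summits.CriticalPhenomena.PercolationContinuityZ3.Theorems.PercNearOneGluingNoHeavyQuantHeavyMixClosure
import HarnessLib

/-!
# QUANT lane R8, T-DEC, leg (III), general second factor: the COMPONENT-WISE HOOK — `gate_q(μ₁ ∗ μ₂)` is DEC as soon as its pieces over
# any decomposition of ONE factor into laws of a common mean are; hence `SingleGateConvClosed` for a second factor that is a mixture of
# admissible SMALL laws of its own mean follows from the small cases

builds on p205010 (kernel theorem, internal audit signed; external expert review pending)

Support file (`--supports stmt-CriticalPhenomena-4575`), QUANT lane seat prim-quant-arm-2 (gen 35), rung R8 of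
`run/shared/lean/prim/quant/LADDER.md`.  Theorems only, standard axioms, no sorries, no definitions.  Bookkeeping companion of this seat's
`…QuantHeavyMixClosure` (`gate_sum_mixture`; census-2 g56's `lconv_sum_right`; typer g22's `decAtT_finite_mixture`).

WHY (memo `run/shared/lean/prim/quant/prim-quant-arm-2-g35/HEAVY-MIX-G35.md` §7).  The heavy-mixture reduction decomposes the second factor into
two-point laws of its mean; a two-point component that is LIGHT cannot be handled alone under a gate.  But the assembly step needs only that the
components (i) share the mean of `μ₂` (so every piece `gate_q(μ₁ ∗ ω_k)` has the common target `q(T₁+T₂)`) and (ii) give DEC pieces — components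
may be ANY small laws.  EXACT CENSUS (seat `work/explore/x10b.py`, parametric LP for the admissible interval of every 3-atom segment): every one of
≈ 1 100 random ADMISSIBLE second factors tested so far (gated law top-affordable and DEC at every layer; 2–7 atoms on `{0..12}`, gates
`q ∈ {1, .9, .75, 2/3, 1/2, 1/3}`, floor at the boundary of admissibility or interior) is a mixture of ADMISSIBLE laws of the same mean with AT MOST
THREE atoms (≈ 85 % even with admissible PAIRS only); kit job j180935 extends the census (evidence on item 4575).  If that persists ("AD3"), the general
second factor of `SingleGateConvClosed` reduces, by the theorems below, to second factors with at most three atoms.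

* **`decAtT_gate_lconv_of_pieces_right`** / `_left` — `μ₂ = Σ v_k ω_k` (resp. `μ₁`), every charged piece `gate_q(μ₁ ∗ ω_k)` DEC at `(x, t, j)` ⟹
  `gate_q(μ₁ ∗ μ₂)` DEC at `(x, t, j)`.
* **`decAt_gate_lconv_of_pieces_right`** — in `SingleGateConvClosed`'s conclusion shape (DEC at the own gated mean, every layer `j′ < M₁ + M₂`):
  if the charged components `ω_k` are probability laws on `{0..M₂}` of the SAME mean and the conclusion holds for each `(μ₁, ω_k)`, it holds for `(μ₁, μ₂)`.
HONEST STATUS: `SingleGateConvClosed`, `WindowMixDEC`, `GatedConvEmptyFree`, `TreeDEC`, `FarTreeRow` remain OPEN; "AD3" is an observation with exact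
evidence, not a theorem.  RATE class log\* / honest sentence unchanged.

[this work]; finite mixtures: prim-quant-stmt g22; `lconv_sum_right`: prim-quant-census-2 g56 (this lane).  Nothing here is cited as a published
result.  The gluing rows served [cite: KozmaNitzan2024, Conjecture 3 (p. 15)]; product measure [cite: Grimmett1999, §1.3 p. 10].
-/

noncomputable section

namespace Summit.CriticalPhenomena.PercolationContinuityZ3.Theorems

namespace Quant

open Finset

namespace LawDec

/-! ### Component-wise hook: the gated convolution is DEC as soon as its pieces over ANY common-target decomposition of one factor are -/

/-- **PIECES OVER A DECOMPOSITION OF THE SECOND FACTOR.**  `μ₁` any law, `μ₂ = Σ_k v_k·ω_k` a finite mixture (`v ≥ 0`, `Σ v = 1`) of laws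
`ω_k`; if for every charged `k` the gated piece `gate_q(μ₁ ∗ ω_k)` is DEC at `(x, t, j)` on `{0..M}`, then so is `gate_q(μ₁ ∗ μ₂)` — the gate is
affine and the convolution is linear in the second factor (`gate_sum_mixture`, `lconv_sum_right`, typer g22's `decAtT_finite_mixture`).  With
components of a COMMON mean the natural target `t = q(T₁ + T₂)` is shared by all pieces; this is the hook by which `SingleGateConvClosed` for a
general second factor reduces to second factors of bounded support whenever the admissible second factor is a mixture of admissible small laws of
its own mean (exact census, memo HEAVY-MIX-G35 §7: 0 exceptions with ≤ 3 atoms). [this work] -/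
theorem decAtT_gate_lconv_of_pieces_right {κ : Type} [Fintype κ] (x t q : ℝ) (j M M₁ M₂ : ℕ) (μ₁ μ₂ : ℕ → ℝ) (v : κ → ℝ)
    (ω : κ → ℕ → ℝ) (hv0 : ∀ k, 0 ≤ v k) (hv1 : ∑ k, v k = 1) (hμ₂ : ∀ h, μ₂ h = ∑ k, v k * ω k h)
    (hpieces : ∀ k, 0 < v k → DECAtT x t j M (gate (lconv M₁ M₂ μ₁ (ω k)) q)) :
    DECAtT x t j M (gate (lconv M₁ M₂ μ₁ μ₂) q) := by
  have e : μ₂ = fun h => ∑ k, v k * ω k h := funext hμ₂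
  have hmix : ∀ h, gate (lconv M₁ M₂ μ₁ μ₂) q h = ∑ k, v k * gate (lconv M₁ M₂ μ₁ (ω k)) q h := by
    intro h
    rw [← gate_sum_mixture v _ q hv1 h, e]
    congr 1
    funext p
    exact lconv_sum_right M₁ M₂ μ₁ v ω p
  exact decAtT_finite_mixture x t j M _ v (fun k => gate (lconv M₁ M₂ μ₁ (ω k)) q) hv0 hv1 hmix hpieces

/-- **PIECES OVER A DECOMPOSITION OF THE FIRST FACTOR** (the same through `lconv_comm`). [this work] -/
theorem decAtT_gate_lconv_of_pieces_left {κ : Type} [Fintype κ] (x t q : ℝ) (j M M₁ M₂ : ℕ) (μ₁ μ₂ : ℕ → ℝ) (v : κ → ℝ)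
    (ω : κ → ℕ → ℝ) (hv0 : ∀ k, 0 ≤ v k) (hv1 : ∑ k, v k = 1) (hμ₁ : ∀ h, μ₁ h = ∑ k, v k * ω k h)
    (hpieces : ∀ k, 0 < v k → DECAtT x t j M (gate (lconv M₁ M₂ (ω k) μ₂) q)) :
    DECAtT x t j M (gate (lconv M₁ M₂ μ₁ μ₂) q) := by
  rw [lconv_comm]
  exact decAtT_gate_lconv_of_pieces_right x t q j M M₂ M₁ μ₂ μ₁ v ω hv0 hv1 hμ₁
    (fun k hk => by rw [lconv_comm]; exact hpieces k hk)

/-- **`SingleGateConvClosed` FOR A SECOND FACTOR THAT IS A MIXTURE OF ADMISSIBLE SMALL LAWS OF ITS OWN MEAN, FROM THE SMALL CASES.**  In the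
binder of `SingleGateConvClosed` (`0 < y`, `0 < q ≤ 1`, `μ₁` a probability law on `{0..M₁}`), let `μ₂ = Σ_k v_k·ω_k` with every charged `ω_k` a
probability law on `{0..M₂}` of the SAME mean `T₂`; if the conclusion of `SingleGateConvClosed` holds for each pair `(μ₁, ω_k)` — `gate_q(μ₁ ∗ ω_k)`
DEC at every layer `j′ < M₁ + M₂` at floor `y` — then it holds for `(μ₁, μ₂)`.  (The piece at its own mean: `q(T₁ + T₂)` for every `k`.) [this work] -/
theorem decAt_gate_lconv_of_pieces_right {κ : Type} [Fintype κ] (y q T₂ : ℝ) (M₁ M₂ : ℕ) (μ₁ μ₂ : ℕ → ℝ) (v : κ → ℝ) (ω : κ → ℕ → ℝ)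
    (hμ1 : ∑ h ∈ Finset.range (M₁ + 1), μ₁ h = 1)
    (hv0 : ∀ k, 0 ≤ v k) (hv1 : ∑ k, v k = 1) (hμ₂ : ∀ h, μ₂ h = ∑ k, v k * ω k h)
    (hω1 : ∀ k, 0 < v k → ∑ h ∈ Finset.range (M₂ + 1), ω k h = 1)
    (hωmean : ∀ k, 0 < v k → ∑ h ∈ Finset.range (M₂ + 1), (h : ℝ) * ω k h = T₂)
    (hpieces : ∀ k, 0 < v k → ∀ j', j' < M₁ + M₂ → DECAt y j' (M₁ + M₂) (gate (lconv M₁ M₂ μ₁ (ω k)) q)) :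
    ∀ j', j' < M₁ + M₂ → DECAt y j' (M₁ + M₂) (gate (lconv M₁ M₂ μ₁ μ₂) q) := by
  intro j' hj'
  set T₁ : ℝ := ∑ h ∈ Finset.range (M₁ + 1), (h : ℝ) * μ₁ h with hT₁
  -- mass and mean of `μ₂`
  have hμ₂1 : ∑ h ∈ Finset.range (M₂ + 1), μ₂ h = 1 := by
    simp_rw [hμ₂]
    rw [Finset.sum_comm]
    have e : ∀ k, ∑ h ∈ Finset.range (M₂ + 1), v k * ω k h = v k := by
      intro k
      rw [← Finset.mul_sum]
      rcases (hv0 k).eq_or_lt with hz | hpos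
      · rw [← hz]; ring
      · rw [hω1 k hpos, mul_one]
    simp_rw [e]; exact hv1
  have hμ₂mean : ∑ h ∈ Finset.range (M₂ + 1), (h : ℝ) * μ₂ h = T₂ := by
    simp_rw [hμ₂]
    have e0 : ∀ h : ℕ, (h : ℝ) * ∑ k, v k * ω k h = ∑ k, v k * ((h : ℝ) * ω k h) := by
      intro h; rw [Finset.mul_sum]; refine Finset.sum_congr rfl fun k _ => ?_; ring
    simp_rw [e0]
    rw [Finset.sum_comm]
    have e : ∀ k, ∑ h ∈ Finset.range (M₂ + 1), v k * ((h : ℝ) * ω k h) = v k * T₂ := by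
      intro k
      rw [← Finset.mul_sum]
      rcases (hv0 k).eq_or_lt with hz | hpos
      · rw [← hz]; ring
      · rw [hωmean k hpos]
    simp_rw [e]
    rw [← Finset.sum_mul, hv1, one_mul]
  rw [decAt_iff_decAtT, sum_mul_gate, sum_mul_lconv M₁ M₂ μ₁ μ₂ hμ1 hμ₂1, hμ₂mean]
  refine decAtT_gate_lconv_of_pieces_right (y) (q * (T₁ + T₂)) q j' (M₁ + M₂) M₁ M₂ μ₁ μ₂ v ω hv0 hv1 hμ₂ (fun k hk => ?_)
  have h := hpieces k hk j' hj'
  rwa [decAt_iff_decAtT, sum_mul_gate, sum_mul_lconv M₁ M₂ μ₁ (ω k) hμ1 (hω1 k hk), hωmean k hk] at h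

end LawDec

end Quant

end Summit.CriticalPhenomena.PercolationContinuityZ3.Theorems
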